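import Mathlib
import HarnessLib
import Summits.Langlands.Langlands.Theses.LiftDescend
import Summits.Langlands.Langlands.Theorems.IrreducibilityBySelfDualityReciprocityUpToIrreducibilityCorrespondsConj

/-!
# Birth skeleton (BC3) for crux stmt-Langlands-1059
`Summit.Langlands.Langlands.Theses.LiftDescend.AutToGalCM` — line `birth`

Route `route-Langlands-LiftDescend` (`closes : AutToGalCM → AutToGalCMtoTR → AscentAutToGal →
PotentialAutomorphy → DescentOfAutomorphy → WeakToStrongGalToAut → Langlands`; the crux is shared verbatim
with route CMFern and is stub 1 of the birth skeleton of `BaseFieldAscent.ReciprocityTRCM`). The crux is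
direction (A) of reciprocity over CM fields, all ranks `n ≥ 1`, ALL weights, with the summit's full clause
list: `∀ F CM, ∃ 𝓡, ∀ n > 0, ∀ hcpt, AutomorphicToGalois n 𝓡 hcpt`, i.e. for every L-algebraic cuspidal `π`
of `GL_n(𝔸_F)` and every `ℓ, ι` an IRREDUCIBLE `ρ_{π,ι}`, GEOMETRIC (unramified a.e., de Rham above `ℓ` for
Fontaine's pinned datum), CORRESPONDING to `π` (Satake–Frobenius a.e. AND local–global compatibility at
EVERY finite place w.r.t. `𝓡`), UNIQUE up to conjugacy.

This file concludes the crux BY NAME from four named stubs, cut along the four seams the literature itself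
respects for automorphic Galois representations over CM fields (construction / irreducibility /
`ℓ ≠ p` compatibility / `ℓ = p` compatibility), the fifth clause (uniqueness) being a THEOREM of the tree:

* `stub_satakeExistenceCM` — CONSTRUCTION (the datum-free core): every L-algebraic cuspidal `π` of
  `GL_n(𝔸_F)`, `F` CM, `n ≥ 1`, has for all `ℓ, ι` SOME `ρ : Γ_F → GL_n(ℚ̄_ℓ)` Satake–Frobenius compatible
  with `(π, ι)` at almost all places (Buzzard–Gee Conj. 3.2.2, weakest form, CM base). Known for REGULAR
  (cohomological) `π`: Harris–Lan–Taylor–Thorne 2016 Thm. A / Scholze 2015 Cor. V.4.2 (tree: named fact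
  `Literature.NumberTheory.Automorphic.exists_galoisRep_of_regularAlgebraic`, C-normalised); OPEN CORE: the
  Hodge-irregular sector (weight-one type in rank `n`, base changes of Maass `λ = 1/4` forms), where not even
  algebraicity of the Satake parameters is known (`NonRegularWeightBarrier`). This is the CM restriction of
  stub W `stub_weakExistence` of line `Sketch` of crux stmt-Langlands-14328 minus its de Rham clause (which
  sits in stub 4 here, with the other `v ∣ ℓ` clause).
* `stub_irreducibleCM` — IRREDUCIBILITY: every `ρ` Satake–Frobenius compatible a.e. with an L-algebraic
  CUSPIDAL `π` over a CM field (`n ≥ 1`) is irreducible (the Irreducibility Conjecture for automorphic Galois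
  representations; Ramakrishnan, Calegari–Gee 2013 §1). Known: `n ≤ 3` classical, `n ≤ 5/6` partially
  (Calegari–Gee 2013, Hui 2023), regular polarizable `π` for a density-one set of `ℓ` (Patrikis–Taylor 2015,
  arXiv:1307.1640); OPEN for all `ℓ` already for regular `π` on `GL_n`, `n ≥ 4` general, and entirely open in
  irregular weight. A HIDDEN open core of the crux as typed (`AutomorphicToGalois` asks `IsIrreducible` for
  EVERY `ℓ, ι`), not named in the route header. Guard `0 < n`: the rank-0 representation is not irreducible
  (negatives index, stmt-Langlands-17212).
* `stub_localGlobalAwayCM` — `ℓ ≠ p` COMPATIBILITY for irreducible compatible pairs, for ONE reciprocity datum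
  per CM field (`∃ 𝓡` lives here and only here): Taylor 2004 Conj. 7 at `v ∤ ℓ`, where the tree's
  Grothendieck–Deligne relation `IsWeilDeligneOfLadic` is a definition, so the clause is meaningful today.
  Known for regular `π` up to the monodromy operator (Varma 2024); monodromy open in general; irregular: open.
  CM restriction of `stub_pairCompatibilityAway` of line `Sketch` (14328) without its de Rham hypothesis.
* `stub_pAdicHodgeCM` — `ℓ = p` COMPATIBILITY (Taylor 2004 Conj. 7 at `v ∣ ℓ` through Fontaine's PINNED
  `D_pst` datum) TOGETHER WITH de Rham-ness above `ℓ`, for every datum `𝓡` already compatible away from `ℓ`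
  (antecedent = body of stub 3 for this `𝓡`). Known sectors: regular conjugate-self-dual (Caraiani 2014),
  `P`-ordinary / Fontaine–Laffaille regular over imaginary CM (Caraiani–Newton 2023 Thm. 1.3 and sequels);
  OPEN in general; and in the PRESENT TREE formally decidable only on the unramified-at-`v` sector (clause (F8)
  of `IsFontaineDatum`; sibling Disproof §C, landed Negative `PinnedFontaineDatumUndecided` of crux 14328) until
  the construction `WD ∘ D_pst` (definition items D1/D2 of `FontaineDpst`) lands — recorded, not hidden.

The composition `AutToGalCM_of` is kernel-checked and sorry-free and is NOT a one-line seam: it takes `𝓡`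
from stub 3, `ρ` from stub 1, irreducibility from stub 2, assembles `IsGeometricFramed 𝓡 ρ` (unramified a.e.
is INSIDE Satake–Frobenius compatibility; de Rham above `ℓ` from stub 4 — `ReciprocityData.pst` is the pinned
datum by `rfl`) and `Corresponds 𝓡 ι π ρ` (case split `ℓ ∈ v` / `ℓ ∉ v` over stubs 4 / 3), and PROVES the
uniqueness clause of `AutomorphicToGalois` from the landed Chebotarev–Brauer–Nesbitt rigidity
`Theorems.ReciprocityUpToIrreducibility.isConjugate_of_satakeFrobCompatibleAt` (two avatars of one `π`, one
irreducible, are conjugate).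

Tightness (informal; each stub is implied by the crux, so none is a strengthening that could die while the
crux lives): stub 1 ⇐ crux (drop clauses); stub 2 ⇐ crux by
`IrreducibleOffSector.isIrreducible_of_satakeFrobCompatible` (irreducibility transfers between a.e.-compatible
avatars); stub 3 ⇐ crux with the crux's own `𝓡` by `corresponds_of_exists_corresponds`; stub 4, de Rham half ⇐
crux by `isGeometricFramed_of_isConjugate`, `v ∣ ℓ` half ⇐ crux along the ℓ-independence argument of the
sibling's landed `…TightnessAbove` (there it needed AC (2.2)/(2.3) only to get irreducibility, which the crux
here supplies outright).

Shape (for `ledger skeleton check` / `#h21_check_skeleton`): each stub is `theorem stub_<name> : <Prop> :=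
by sorry` (closed statements over existing declarations only); `_Goal.stub_<name> : Prop := type_of%
@stub_<name>` names that statement; `AutToGalCM_of (h₁ : _Goal.stub_satakeExistenceCM)
(h₂ : _Goal.stub_irreducibleCM) (h₃ : _Goal.stub_localGlobalAwayCM) (h₄ : _Goal.stub_pAdicHodgeCM) :
AutToGalCM` concludes the route decl BY NAME; the last `example` feeds the four stubs to it.

Disproof used: none exists — `ledger crux ls stmt-Langlands-1059` lists no workfiles (no `Disproof.lean`, no
`Negative/` lemma, no dead line, no crux ideas) at registration time (2026-08-17); `ledger negatives --problem
Langlands` (3 entries: SplitPrimeInductionDeinduction, OrdinaryPrimeTransportRankinSelbergPoleCount,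
K3KugaSatakeDescentSerreTypeAnchor) contains nothing of the shape of these stubs; the one lesson that transfers
(17212: rank `0` data are cuspidal-compatible but not irreducible) is honoured by the guard `0 < n` in every
stub. The sibling crux's disproof file (14328 `Disproof.lean` §B–§D) is honoured by the away/above split of
local–global compatibility (stubs 3/4).
-/

set_option linter.dupNamespace false

noncomputable section

namespace Summit.Langlands.Langlands.Cruxes.AutToGalCM.Birth

open Summit.Langlands.Langlands.Theses.LiftDescend
open Literature.NumberTheory.Automorphic Literature.NumberTheory.GaloisRepresentations
open Filter IsDedekindDomain
open scoped NumberField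

/-! ## 1. The four stubs -/

/-- **STUB 1 — construction of the compatible system over CM fields, all ranks, ALL weights (datum-free
core of direction (A); Buzzard–Gee Conj. 3.2.2 in its weakest form, CM base).** For a CM field `F`, every
L-algebraic cuspidal `π` of `GL_n(𝔸_F)`, `n ≥ 1`, has for all `ℓ` and `ι : ℚ̄_ℓ ≃ ℂ` SOME
`ρ : Γ_F → GL_n(ℚ̄_ℓ)` which is Satake–Frobenius compatible with `(π, ι)` at all but finitely many places
(`SatakeFrobCompatibleAt` includes unramifiedness of `ρ` at those places; no irreducibility, no de Rham
clause, no local–global compatibility, no uniqueness asked). Regular (cohomological) `π`: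
Harris–Lan–Taylor–Thorne Thm. A / Scholze Cor. V.4.2 (tree named fact
`exists_galoisRep_of_regularAlgebraic`, C-normalisation — the L-normalised form is a twist bookkeeping).
OPEN CORE: Hodge-irregular `π` (no realisation in any cohomology theory; even algebraicity of the Satake
parameters, forced here by the `∀ ι` clause, is open). Why it might fail as typed: an L-algebraic cuspidal
`π` with a transcendental Satake parameter has no such `ρ` for generic `ι`.
[cite: HarrisLanTaylorThorneRMS2016, Thm. A] [cite: Scholze2015, Cor. V.4.2] [cite: BuzzardGeeLMS2014, Conj. 3.2.2] -/
theorem stub_satakeExistenceCM : ∀ (F : Type) [Field F] [NumberField F], NumberField.IsCMField F → ∀ (n : ℕ) (hcpt : isCompact_glFiniteIntegralLevel n F), 0 < n → ∀ π : CuspidalAutomorphicRepData n F hcpt, π.1.IsLAlgebraic → ∀ (ℓ : ℕ) [Fact ℓ.Prime] (ι : PadicAlgCl ℓ ≃+* ℂ), ∃ ρ : FramedGaloisRep F (PadicAlgCl ℓ) n, ∀ᶠ v : HeightOneSpectrum (𝓞 F) in cofinite, SatakeFrobCompatibleAt ι π.1 ρ v := by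
  sorry

/-- **STUB 2 — irreducibility of compatible avatars of CUSPIDAL `π` over CM fields (the Irreducibility
Conjecture for automorphic Galois representations).** For a CM field `F`, `n ≥ 1`, an L-algebraic cuspidal
`π` of `GL_n(𝔸_F)` and any `ℓ, ι`: every `ρ : Γ_F → GL_n(ℚ̄_ℓ)` Satake–Frobenius compatible with `(π, ι)` at
almost all places is irreducible. (Irreducibility transfers between a.e.-compatible avatars — tree:
`IrreducibleOffSector.isIrreducible_of_satakeFrobCompatible` — so this is exactly "ρ_{π,ι} is irreducible"
whenever some avatar exists, and vacuous otherwise.) Known: `n ≤ 3`; `n ≤ 5` resp. `≤ 6` in many cases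
(Calegari–Gee 2013, Hui 2023); regular polarizable `π` for a density-ONE set of `ℓ` (Patrikis–Taylor 2015,
arXiv:1307.1640). OPEN for all `ℓ` in general rank, and entirely open in irregular weight — a hidden open
core of the crux as typed (`AutomorphicToGalois` demands `IsIrreducible` at every `ℓ, ι`). Guard `0 < n`:
the rank-0 representation is Satake-compatible with the rank-0 cuspidal datum but NOT irreducible
(negatives index, stmt-Langlands-17212). Why it might fail: only through a genuinely reducible `ρ_{π,ℓ}` for
a cuspidal `π`, contradicting cuspidality ⇒ irreducibility (believed; implied by reciprocity (A)+(B) via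
Jacquet–Shalika, cf. line `Sketch` of crux 14328).
[cite: CalegariGee2013, §1] [cite: Hui2023, Thm. 1.1] -/
theorem stub_irreducibleCM : ∀ (F : Type) [Field F] [NumberField F], NumberField.IsCMField F → ∀ (n : ℕ) (hcpt : isCompact_glFiniteIntegralLevel n F), 0 < n → ∀ π : CuspidalAutomorphicRepData n F hcpt, π.1.IsLAlgebraic → ∀ (ℓ : ℕ) [Fact ℓ.Prime] (ι : PadicAlgCl ℓ ≃+* ℂ) (ρ : FramedGaloisRep F (PadicAlgCl ℓ) n), (∀ᶠ v : HeightOneSpectrum (𝓞 F) in cofinite, SatakeFrobCompatibleAt ι π.1 ρ v) → ρ.toGaloisRep.IsIrreducible := by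
  sorry

/-- **STUB 3 — local–global compatibility AWAY from `ℓ` for irreducible compatible pairs, for ONE
reciprocity datum per CM field (Taylor 2004 Conj. 7 at `v ∤ ℓ`; the only stub with `∃ 𝓡`).** For every CM
field `F` there are reciprocity data `𝓡` (the Harris–Taylor local Langlands correspondences `rec_v`) such
that for every L-algebraic cuspidal `π` of `GL_n(𝔸_F)`, `n ≥ 1`, every `ℓ, ι` and every IRREDUCIBLE `ρ`
Satake–Frobenius compatible with `(π, ι)` a.e., `LocalGlobalCompatibleAt 𝓡 ι π ρ v` holds at every finite
`v ∤ ℓ`: `ι WD(ρ|_{W_{F_v}})^{F-ss} ≅ rec_v(π_v)` with `WD` by the Grothendieck–Deligne recipe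
(`IsWeilDeligneOfLadic`, a definition of the tree — this half is meaningful today). Known for regular `π`
up to semisimplification / the monodromy operator (Varma 2024, for the HLTT–Scholze representations);
monodromy open in general (cf. card eisenstein-degeneration-monodromy); irregular weight: open with stub 1.
Why it might fail as typed: only with the summit (a junk normalisation of `rec_v` is excluded by `∃ 𝓡`
ranging over `LocalLanglandsDatum`, and the clause is implied by (A) for the crux's own `𝓡` via the tree's
`corresponds_of_exists_corresponds`).
[cite: TaylorGaloisRepresentations2004, Conj. 3.4] [cite: VarmaFMS2024, Thm. 1] [cite: HarrisTaylorAMS2001, Thm. A] -/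
theorem stub_localGlobalAwayCM : ∀ (F : Type) [Field F] [NumberField F], NumberField.IsCMField F → ∃ R : ReciprocityData F, ∀ (n : ℕ) (hcpt : isCompact_glFiniteIntegralLevel n F), 0 < n → ∀ π : CuspidalAutomorphicRepData n F hcpt, π.1.IsLAlgebraic → ∀ (ℓ : ℕ) [Fact ℓ.Prime] (ι : PadicAlgCl ℓ ≃+* ℂ) (ρ : FramedGaloisRep F (PadicAlgCl ℓ) n), ρ.toGaloisRep.IsIrreducible → (∀ᶠ v : HeightOneSpectrum (𝓞 F) in cofinite, SatakeFrobCompatibleAt ι π.1 ρ v) → ∀ v : HeightOneSpectrum (𝓞 F), ((ℓ : ℕ) : 𝓞 F) ∉ v.asIdeal → LocalGlobalCompatibleAt R ι π.1 ρ v := by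
  sorry

/-- **STUB 4 — the `p`-adic Hodge clauses above `ℓ` (Taylor 2004 Conj. 7 at `v ∣ ℓ` + Fontaine–Mazur
geometricity): de Rham-ness AND local–global compatibility through Fontaine's PINNED `D_pst` datum, for every
reciprocity datum already compatible away from `ℓ`.** For a CM field `F` and reciprocity data `𝓡` satisfying
the body of stub 3 (compatibility at all `v ∤ ℓ` for all irreducible compatible pairs in all ranks), every
irreducible `ρ` Satake–Frobenius compatible a.e. with an L-algebraic cuspidal `π` (`n ≥ 1`) is, at every
`v ∣ ℓ`, de Rham for the pinned datum `fontainePstAdicCompletion v ℓ hv` (= `𝓡.pst ℓ v hv` by `rfl`) and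
locally–globally compatible with `π` there. Known sectors: regular conjugate-self-dual `π` (Caraiani 2014:
`ℓ = p` compatibility incl. monodromy), `P`-ordinary / Fontaine–Laffaille regular `π` over imaginary CM fields
(Caraiani–Newton 2023 Thm. 1.3 and sequels), de Rham-ness of the HLTT–Scholze representations in further
regular cases (A'Campo 2024); OPEN in general, open with stub 1 in irregular weight. PRESENT-TREE STATUS
(recorded, not hidden): the pinned datum is Hilbert's `ε` over `IsFontaineDatum`; by the sibling disproof
(crux 14328, Disproof §C, landed Negative `PinnedFontaineDatumUndecided`) the `v ∣ ℓ` clause is formally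
decidable today only on the unramified-at-`v` sector (clause (F8)), pending the construction `WD ∘ D_pst`
(definition items D1/D2 of `FontaineDpst`). Why it might fail as typed: a reciprocity datum compatible away
from `ℓ` is pinned on every local component class by ℓ-independence, so failure again means failure of (A).
[cite: TaylorGaloisRepresentations2004, Conj. 3.5] [cite: Caraiani2014, Thm. 1.1] [cite: CaraianiNewton2023, Thm. 1.3] [cite: FontaineAsterisque223VIII, §2.3.7] [cite: FontaineMazurGeometric1995, §1] -/
theorem stub_pAdicHodgeCM : ∀ (F : Type) [Field F] [NumberField F], NumberField.IsCMField F → ∀ R : ReciprocityData F, (∀ (n : ℕ) (hcpt : isCompact_glFiniteIntegralLevel n F), 0 < n → ∀ π : CuspidalAutomorphicRepData n F hcpt, π.1.IsLAlgebraic → ∀ (ℓ : ℕ) [Fact ℓ.Prime] (ι : PadicAlgCl ℓ ≃+* ℂ) (ρ : FramedGaloisRep F (PadicAlgCl ℓ) n), ρ.toGaloisRep.IsIrreducible → (∀ᶠ v : HeightOneSpectrum (𝓞 F) in cofinite, SatakeFrobCompatibleAt ι π.1 ρ v) → ∀ v : HeightOneSpectrum (𝓞 F), ((ℓ : ℕ)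 : 𝓞 F) ∉ v.asIdeal → LocalGlobalCompatibleAt R ι π.1 ρ v) → ∀ (n : ℕ) (hcpt : isCompact_glFiniteIntegralLevel n F), 0 < n → ∀ π : CuspidalAutomorphicRepData n F hcpt, π.1.IsLAlgebraic → ∀ (ℓ : ℕ) [Fact ℓ.Prime] (ι : PadicAlgCl ℓ ≃+* ℂ) (ρ : FramedGaloisRep F (PadicAlgCl ℓ) n), ρ.toGaloisRep.IsIrreducible → (∀ᶠ v : HeightOneSpectrum (𝓞 F) in cofinite, SatakeFrobCompatibleAt ι π.1 ρ v) → ∀ (v : HeightOneSpectrum (𝓞 F)) (hv : ((ℓ : ℕ) : 𝓞 F) ∈ v.asIdeal), (Literature.NumberTheory.PAdicHodge.fontainePstAdicCompletion v ℓ hv).IsDeRhamFramed (ρ.toLocal v) ∧ LocalGlobalCompatibleAt R ι π.1 ρ v := by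
  sorry

/-! ## 2. The stub statements as named propositions (the composition's hypotheses, by name)

`_Goal` is internal on purpose: audits listing the file's declarations by short name find the `stub_*`
THEOREMS, while `#h21_check_skeleton` accepts the hypotheses of `AutToGalCM_of` by the stub names they
carry. Each `_Goal.stub_x` is `type_of% @stub_x` — no text duplicated, no `sorry` inherited. -/

namespace _Goal

/-- The statement of `stub_satakeExistenceCM`, as a named `Prop` (literally its type). [folklore] -/
def stub_satakeExistenceCM : Prop :=
  type_of% @Summit.Langlands.Langlands.Cruxes.AutToGalCM.Birth.stub_satakeExistenceCM

/-- The statement of `stub_irreducibleCM`, as a named `Prop` (literally its type). [folklore] -/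
def stub_irreducibleCM : Prop :=
  type_of% @Summit.Langlands.Langlands.Cruxes.AutToGalCM.Birth.stub_irreducibleCM

/-- The statement of `stub_localGlobalAwayCM`, as a named `Prop` (literally its type). [folklore] -/
def stub_localGlobalAwayCM : Prop :=
  type_of% @Summit.Langlands.Langlands.Cruxes.AutToGalCM.Birth.stub_localGlobalAwayCM

/-- The statement of `stub_pAdicHodgeCM`, as a named `Prop` (literally its type). [folklore] -/
def stub_pAdicHodgeCM : Prop :=
  type_of% @Summit.Langlands.Langlands.Cruxes.AutToGalCM.Birth.stub_pAdicHodgeCM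

end _Goal

/-! ## 3. The composition (kernel-checked, no `sorry`): construction → irreducibility → LGC away/above →
uniqueness (a theorem) → crux by name -/

/-- **`AutToGalCM` from the four stubs.** For a CM field `F`: `𝓡` from stub 3 (compatibility away from
`ℓ`), upgraded above `ℓ` by stub 4; for an L-algebraic cuspidal `π`, `ℓ`, `ι`: `ρ` from stub 1,
irreducible by stub 2; `IsGeometricFramed 𝓡 ρ` = unramified a.e. (inside Satake–Frobenius compatibility) ∧
de Rham above `ℓ` (stub 4; `𝓡.pst` is the pinned datum by `rfl`); `Corresponds 𝓡 ι π ρ` = the a.e. clause ∧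
local–global compatibility at every finite `v` (case `ℓ ∈ v`: stub 4, `ℓ ∉ v`: stub 3); uniqueness up to
conjugacy among all corresponding `ρ'` is the landed Chebotarev–Brauer–Nesbitt rigidity
`isConjugate_of_satakeFrobCompatibleAt`. The hypotheses are, by name, the statements of the four stubs; the
conclusion is the route decl. [cite: DeligneSerreASENS1974, Lemme 3.2] -/
theorem AutToGalCM_of (h₁ : _Goal.stub_satakeExistenceCM) (h₂ : _Goal.stub_irreducibleCM)
    (h₃ : _Goal.stub_localGlobalAwayCM) (h₄ : _Goal.stub_pAdicHodgeCM) : AutToGalCM := by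
  unfold _Goal.stub_satakeExistenceCM at h₁
  unfold _Goal.stub_irreducibleCM at h₂
  unfold _Goal.stub_localGlobalAwayCM at h₃
  unfold _Goal.stub_pAdicHodgeCM at h₄
  intro F _ _ hF
  -- the reciprocity datum: compatible away from `ℓ` (stub 3), hence also above `ℓ` (stub 4)
  obtain ⟨R, hAway⟩ := h₃ F hF
  have hAbove := h₄ F hF R hAway
  refine ⟨R, fun n hn hcpt π hL ℓ _ ι => ?_⟩
  -- the representation: exists (stub 1), irreducible (stub 2)
  obtain ⟨ρ, hρ⟩ := h₁ F hF n hcpt hn π hL ℓ ι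
  have hirr : ρ.toGaloisRep.IsIrreducible := h₂ F hF n hcpt hn π hL ℓ ι ρ hρ
  -- local–global compatibility at every finite place
  have hLGC : ∀ v : HeightOneSpectrum (𝓞 F), LocalGlobalCompatibleAt R ι π.1 ρ v := fun v => by
    by_cases hv : ((ℓ : ℕ) : 𝓞 F) ∈ v.asIdeal
    · exact (hAbove n hcpt hn π hL ℓ ι ρ hirr hρ v hv).2
    · exact hAway n hcpt hn π hL ℓ ι ρ hirr hρ v hv
  -- geometric: unramified a.e. (Satake clause) and de Rham above `ℓ` for the pinned datum
  have hgeo : IsGeometricFramed R ρ :=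
    ⟨hρ.mono fun v hv => by
        obtain ⟨α, -, hur, -⟩ := hv
        exact hur,
      fun v hv => (hAbove n hcpt hn π hL ℓ ι ρ hirr hρ v hv).1⟩
  have hcorr : Corresponds R ι π.1 ρ := ⟨hρ, hLGC⟩
  -- uniqueness up to conjugacy: Chebotarev + Brauer–Nesbitt (tree)
  exact ⟨ρ, hirr, hgeo, hcorr, fun ρ' h' =>
    Theorems.ReciprocityUpToIrreducibility.isConjugate_of_satakeFrobCompatibleAt π.1 ι hirr hρ h'.1⟩

/-- By-name sanity check (an `example`, not a declaration of the file): the four stubs feed the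
composition as they stand. -/
example : AutToGalCM :=
  AutToGalCM_of stub_satakeExistenceCM stub_irreducibleCM stub_localGlobalAwayCM stub_pAdicHodgeCM

end Summit.Langlands.Langlands.Cruxes.AutToGalCM.Birth

end
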